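import Summits.BirchSwinnertonDyer.BirchSwinnertonDyer.Theorems.ByReductionTypeAtTwoSupersingularFlatBlindTwistSideLattice
import HarnessLib

/-!
# Rank one at finite level, UNIFORMLY in the level, II: the strict count `#(Sel^{(p^k)} ∩ ker res_E)` and the
# relaxation index `[kummerOutside {v} : Sel^{(p^k)}]` (hand HT-2 of crux `SupersingularRankZeroAtTwo`, twist side)

Cell `bsd-2adic`, seat `bsd-2adic-tower-1` GEN 58, `--supports stmt-BirchSwinnertonDyer-19097` (helper). HONEST FRAMING:
THEOREMS ONLY (no `def`, no named fact, no instance, no `sorry`); nothing is booked; `SupersingularRankZeroAtTwo`,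
CDF_glob and BSD are NOT proved by any of this. Continuation of `…FlatBlindTwistSideLattice.lean` (§1 lattice algebra,
§2 Silverman VII.6.3 on `E(ℚ_v)`). Jetchev–Skinner–Wan 2017 Prop. 3.2.1 `≤` at every level `p^k` for a rank-one curve,
with the bound independent of `k`:
* §3 `exists_natCard_selmerGroup_inf_ker_res_le` — `∃ C, ∀ k, #(Sel^{(p^k)}(E/K) ∩ ker res_E) ≤ C` (rank 1, `Ш[p^∞]`
  finite, `λ : E(E) →+ ℤ_p` killing exactly torsion; the tree's Part A `X11b.StrictAtPlace.natCard_selmerGroup_inf_ker_res_le`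
  + `#Ш[p^k] ≤ #Ш[p^∞]` + `#(κ(E(K)) ∩ ker res_E) ≤ p^{v_p λ(P₁)} · #E(K)_tors`);
* §4 `exists_relIndex_selmerGroup_kummerOutside_le` — `∃ C, ∀ k ≥ 1, [kummerOutside E p^k {v} : Sel^{(p^k)}(E/K)] ≤ C`
  (the tree's `X11b.Relaxation.relIndex_selmerGroup_kummerOutside_le_index_zmultiples_of_facts` at `ξ = κ(P₁)`, fed by
  `poitouTate_sum_localTatePairing_eq_zero_holds` and `localEulerPoincareCharacteristic_holds`, then §1's lattice bound).

References: [JetchevSkinnerWan2017] Prop. 3.2.1 (arXiv:1512.06894 pp. 10–11); [Skinner2020] §2.2 Lemma `rank1lemma`;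
[SilvermanAEC2009] Prop. VII.6.3, VIII.§2, X.§4; [MilneADT2006] I Thm. 2.8, Thm. 4.10 (b).
-/

set_option autoImplicit false
set_option linter.dupNamespace false

noncomputable section

open scoped Classical

universe u

namespace Summit.BirchSwinnertonDyer.BirchSwinnertonDyer.Theorems.FlatBlindTwistSide

open Field NumberField IsDedekindDomain WeierstrassCurve Function
open Literature.NumberTheory.EllipticCurves Literature.NumberTheory.GaloisRepresentations
  Literature.NumberTheory.GaloisCohomology

/-! ## §3 The strict count: `#(Sel^{(p^k)}(E/K) ∩ ker res_E)` is bounded independently of `k` -/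

section Strict

variable {K : Type u} [Field K] [NumberField K] (W : WeierstrassCurve K) [W.IsElliptic] (p : ℕ) [Fact p.Prime]

omit [W.IsElliptic] [Fact p.Prime] in
/-- `#Ш(E/K)[p^k] ≤ #Ш(E/K)[p^∞]` (the `p^k`-torsion of `Ш` lies in its `p`-primary part). [folklore] -/
theorem natCard_sha_inf_torsionBy_le [Finite (AddCommGroup.primaryComponent W.sha p)] (k : ℕ) :
    Nat.card ↥(W.sha ⊓ AddSubgroup.torsionBy W.galH1 (((p ^ k : ℕ) : ℤ))) ≤
      Nat.card (AddCommGroup.primaryComponent W.sha p) := by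
  refine Nat.card_le_card_of_injective
    (fun x ↦ (⟨⟨x.1, x.2.1⟩, (AddCommGroup.mem_primaryComponent).mpr ⟨k, Subtype.ext ?_⟩⟩ :
      AddCommGroup.primaryComponent W.sha p)) ?_
  · have h2 : (((p ^ k : ℕ) : ℤ)) • (x.1 : W.galH1) = 0 := x.2.2
    rw [AddSubgroupClass.coe_nsmul, ZeroMemClass.coe_zero, ← natCast_zsmul]
    exact h2
  · intro x y hxy
    apply Subtype.ext
    exact congrArg (fun z : AddCommGroup.primaryComponent W.sha p ↦ ((z : W.sha) : W.galH1)) hxy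

variable (E : Type u) [Field E] [Algebra K E] [CharZero E]

/-- **The strict count, uniform in the level.** For an elliptic curve `E = W` over a number field `K` with
`rank_ℤ E(K) = 1`, `Ш(E/K)[p^∞]` finite, finite torsion `E(K)_tors`, and a `K`-field `E` (a completion) carrying
`λ : E(E) →+ ℤ_p` vanishing exactly on torsion: `∃ C, ∀ k, #(Sel^{(p^k)}(E/K) ∩ ker res_E) ≤ C`. Proof: Part A of
JSW17 Prop. 3.2.1 in the tree's form `# ≤ #Ш[p^k] · #(κ(E(K)) ∩ ker res_E)`
(`X11b.StrictAtPlace.natCard_selmerGroup_inf_ker_res_le`); `#Ш[p^k] ≤ #Ш[p^∞]`; and a Kummer class `κ(P)`,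
`P = b P₁ + t`, dying at `E` has `P ∈ p^k E(E)`, so `p^{k − a} ∣ b` with `a = v_p λ(P₁)`, whence
`κ(P) = b'·κ(p^{k−a}P₁) + κ(t)` with `b'` read modulo `p^a`: at most `p^a · #E(K)_tors` classes.
[cite: JetchevSkinnerWan2017, Prop. 3.2.1 (proof)] [cite: Skinner2020, §2.2 Lemma rank1lemma] -/
theorem exists_natCard_selmerGroup_inf_ker_res_le (lam : (W.baseChange E).toAffine.Point →+ ℤ_[p])
    (hlam : ∀ X, lam X = 0 ↔ IsOfFinAddOrder X) (hrank : W.mordellWeilRank = 1)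
    [Finite (AddCommGroup.primaryComponent W.sha p)] [Finite (AddCommGroup.torsion W.toAffine.Point)] :
    ∃ C : ℕ, ∀ k : ℕ,
      Nat.card ↥(selmerGroup W (((p ^ k : ℕ) : ℤ)) ⊓
        (galoisCohomology.res (W.torsionGaloisModule (((p ^ k : ℕ) : ℤ))) E 1).ker) ≤ C := by
  have hp : p.Prime := Fact.out
  haveI : PerfectField E := PerfectField.ofCharZero
  obtain ⟨P₁, hP₁, hgen⟩ := exists_generator_of_mordellWeilRank_eq_one W hrank
  let bc : W.toAffine.Point →+ (W.baseChange E).toAffine.Point := Affine.Point.baseChange (W' := W) K E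
  have hinj : Function.Injective bc := Affine.Point.map_injective (W' := W) (Algebra.ofId K E)
  have htors : ∀ {x : W.toAffine.Point}, IsOfFinAddOrder x → IsOfFinAddOrder (bc x) :=
    fun hx ↦ bc.isOfFinAddOrder hx
  have hu0 : lam (bc P₁) ≠ 0 := by
    intro h0
    apply hP₁
    obtain ⟨m, hm, hmP⟩ := isOfFinAddOrder_iff_nsmul_eq_zero.mp ((hlam _).mp h0)
    refine isOfFinAddOrder_iff_nsmul_eq_zero.mpr ⟨m, hm, hinj ?_⟩
    rw [map_nsmul, map_zero]
    exact hmP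
  set a : ℕ := (lam (bc P₁)).valuation with ha
  refine ⟨Nat.card (AddCommGroup.primaryComponent W.sha p) *
    (p ^ a * Nat.card (AddCommGroup.torsion W.toAffine.Point)), fun k ↦ ?_⟩
  have hn0 : (((p ^ k : ℕ) : ℤ)) ≠ 0 := by exact_mod_cast pow_ne_zero k hp.ne_zero
  have hdiv : ∀ P : geomPoints W, ∃ Q : geomPoints W, (((p ^ k : ℕ) : ℤ)) • Q = P :=
    fun P ↦ W.zsmul_geomPoints_surjective_holds hn0 P
  refine (Summit.BirchSwinnertonDyer.Rank1Residual.X11b.StrictAtPlace.natCard_selmerGroup_inf_ker_res_le W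
    E hn0 hdiv).trans (Nat.mul_le_mul (natCard_sha_inf_torsionBy_le W p k) ?_)
  -- the Kummer classes dying at `E`
  set κ := kummerMapTorsion W (((p ^ k : ℕ) : ℤ)) hdiv with hκ
  set y₀ := κ (((p : ℤ) ^ (k - a)) • P₁) with hy₀
  -- `p^a • y₀ = 0`
  have hy₀0 : ((p : ℤ) ^ a) • y₀ = 0 := by
    rw [hy₀, ← map_zsmul, smul_smul, ← pow_add]
    have hle : k ≤ a + (k - a) := le_add_tsub
    obtain ⟨j, hj⟩ := Nat.exists_eq_add_of_le hle
    rw [hj, pow_add, mul_comm, ← smul_smul, ← AddMonoidHom.mem_ker, kummerMapTorsion_ker]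
    exact ⟨((p : ℤ) ^ j) • P₁, by rw [zsmulAddGroupHom_apply, Nat.cast_pow, smul_comm]⟩
  -- every class of `κ(E(K)) ∩ ker res_E` is `i • y₀ + κ t`, `i < p^a`, `t` torsion
  let F : Fin (p ^ a) × AddCommGroup.torsion W.toAffine.Point → galH1Torsion W (((p ^ k : ℕ) : ℤ)) :=
    fun z ↦ ((z.1 : ℕ) : ℤ) • y₀ + κ (z.2 : W.toAffine.Point)
  have hF : ∀ c ∈ κ.range ⊓ (galoisCohomology.res (W.torsionGaloisModule (((p ^ k : ℕ) : ℤ))) E 1).ker,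
      ∃ z, F z = c := by
    rintro c ⟨⟨P, rfl⟩, hc⟩
    obtain ⟨R, hR⟩ := exists_baseChange_eq_zsmul_of_res_kummerMapTorsion_eq_zero W hdiv E P hc
    obtain ⟨b, t, ht, rfl⟩ := hgen P
    -- `p^k ∣ b · λ(P₁)`
    have hdvd : (p : ℤ_[p]) ^ k ∣ (b : ℤ_[p]) * lam (bc P₁) := by
      have h1 := congrArg lam hR
      change lam (bc (b • P₁ + t)) = lam ((((p ^ k : ℕ) : ℤ)) • R) at h1
      simp only [map_add, map_zsmul] at h1
      rw [(hlam _).mpr (htors ht), add_zero] at h1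
      refine ⟨lam R, ?_⟩
      rw [← zsmul_eq_mul, h1, zsmul_eq_mul, Int.cast_natCast, Nat.cast_pow]
    obtain ⟨b', hb'⟩ := pow_sub_valuation_dvd_of_pow_dvd_mul p hu0 hdvd
    -- reduce `b'` modulo `p^a`
    have hpa : (0 : ℤ) < (p : ℤ) ^ a := pow_pos (by exact_mod_cast hp.pos) a
    set i : ℤ := b' % (p : ℤ) ^ a with hi
    have hi0 : 0 ≤ i := Int.emod_nonneg _ hpa.ne'
    have hilt : i < (p : ℤ) ^ a := Int.emod_lt_of_pos _ hpa
    have hinat : (i.toNat : ℤ) = i := Int.toNat_of_nonneg hi0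
    have hilt' : i.toNat < p ^ a := by
      have : (i.toNat : ℤ) < ((p ^ a : ℕ) : ℤ) := by rw [hinat, Nat.cast_pow]; exact hilt
      exact_mod_cast this
    refine ⟨(⟨i.toNat, hilt'⟩, ⟨t, (AddCommGroup.mem_torsion t).mpr ht⟩), ?_⟩
    change ((i.toNat : ℕ) : ℤ) • y₀ + κ t = κ (b • P₁ + t)
    rw [hinat, map_add]
    congr 1
    -- `b • P₁ = b' • (p^{k-a} • P₁)` and `b' • y₀ = i • y₀`
    have hb : b • P₁ = b' • (((p : ℤ) ^ (k - a)) • P₁) := by rw [smul_smul, mul_comm, ← hb']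
    rw [hb, map_zsmul, ← hy₀]
    have hdecomp : b' = i + (p : ℤ) ^ a * (b' / (p : ℤ) ^ a) := by rw [hi, Int.emod_add_mul_ediv]
    conv_rhs => rw [hdecomp]
    rw [add_zsmul, mul_comm, mul_zsmul, hy₀0, zsmul_zero, add_zero]
  -- count
  have hcard : Nat.card (Fin (p ^ a) × AddCommGroup.torsion W.toAffine.Point) =
      p ^ a * Nat.card (AddCommGroup.torsion W.toAffine.Point) := by
    rw [Nat.card_prod, Nat.card_eq_fintype_card, Fintype.card_fin]
  rw [← hcard]
  refine Nat.card_le_card_of_injective (fun c ↦ Classical.choose (hF c.1 c.2)) fun c c' h ↦ ?_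
  apply Subtype.ext
  rw [← Classical.choose_spec (hF c.1 c.2), ← Classical.choose_spec (hF c'.1 c'.2)]
  exact congrArg F h

end Strict

/-! ## §4 The relaxation index `[kummerOutside {v} : Sel^{(p^k)}]` is bounded independently of `k` -/

section Relaxed

variable {K : Type} [Field K] [NumberField K] (W : WeierstrassCurve K) [W.IsElliptic] (p : ℕ) [Fact p.Prime]
  (v : HeightOneSpectrum (𝓞 K))

omit [W.IsElliptic] in
/-- A Kummer class `κ_n(P)` of a rational point lies in `kummerOutside W n S` for every `S` (it satisfies the
local Kummer condition everywhere). [cite: SilvermanAEC2009, X.§4] -/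
theorem kummerMapTorsion_mem_kummerOutside (n : ℕ) [NeZero n]
    (hdiv : ∀ P : geomPoints W, ∃ Q : geomPoints W, (n : ℤ) • Q = P) (S : Finset (Place K))
    (P : W.toAffine.Point) : kummerMapTorsion W (n : ℤ) hdiv P ∈ kummerOutside W n S := by
  have h := (W.mem_selmerGroup_iff_forall_localization_mem (n : ℤ) _).mp
    (Summit.BirchSwinnertonDyer.Rank1Residual.X11b.StrictAtPlace.kummerMapTorsion_mem_selmerGroup W hdiv P)
  exact (mem_kummerOutside_iff W n S _).mpr fun w _ ↦ (W.kummerSelmerStructure_apply (n : ℤ) w) ▸ h w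

/-- **The relaxation index, uniform in the level.** For an elliptic curve `E = W` over a number field `K` with
`rank_ℤ E(K) = 1` and a finite place `v` at which `E(K_v)` has a finite-index subgroup `U ≃+ ℤ_p`:
`∃ C, ∀ k ≥ 1, [kummerOutside E p^k {v} : Sel^{(p^k)}(E/K)] ≤ C`. Proof: the tree's relaxation bound
`[H¹_{𝓛, ⊤ at v} : Sel⁽ⁿ⁾] ≤ [E(K_v) : ℤ·P₁ + nE(K_v)]` at the Kummer class `ξ = κ_n(P₁)` of a generator
(`X11b.Relaxation.relIndex_selmerGroup_kummerOutside_le_index_zmultiples_of_facts`, from Poitou–Tate reciprocity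
`poitouTate_sum_localTatePairing_eq_zero_holds` and Tate's local Euler characteristic
`localEulerPoincareCharacteristic_holds`), and `[E(K_v) : ℤ·P₁ + p^k E(K_v)] ≤ [E(K_v) : U]·p^a` (§1).
[cite: JetchevSkinnerWan2017, Prop. 3.2.1 (proof, arXiv:1512.06894 pp. 10–11)] [cite: MilneADT2006, Ch. I, Thm. 4.10 (b), Thm. 2.8] -/
theorem exists_relIndex_selmerGroup_kummerOutside_le
    (U : AddSubgroup (W.baseChange (v.adicCompletion K)).toAffine.Point) [U.FiniteIndex] (e : U ≃+ ℤ_[p])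
    (hrank : W.mordellWeilRank = 1) :
    ∃ C : ℕ, ∀ k : ℕ, 1 ≤ k →
      (selmerGroup W (((p ^ k : ℕ) : ℤ))).relIndex (kummerOutside W (p ^ k) {Sum.inr v}) ≤ C := by
  have hp : p.Prime := Fact.out
  haveI : CharZero (v.adicCompletion K) := charZero_of_injective_algebraMap (algebraMap K _).injective
  obtain ⟨P₁, hP₁, -⟩ := exists_generator_of_mordellWeilRank_eq_one W hrank
  let bc : W.toAffine.Point →+ (W.baseChange (v.adicCompletion K)).toAffine.Point :=
    Affine.Point.baseChange (W' := W) K (v.adicCompletion K)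
  have hinj : Function.Injective bc := Affine.Point.map_injective (W' := W) (Algebra.ofId K _)
  have hx : ¬ IsOfFinAddOrder (bc P₁) := by
    intro h
    apply hP₁
    obtain ⟨m, hm, hmP⟩ := isOfFinAddOrder_iff_nsmul_eq_zero.mp h
    refine isOfFinAddOrder_iff_nsmul_eq_zero.mpr ⟨m, hm, hinj ?_⟩
    rw [map_nsmul, map_zero]
    exact hmP
  obtain ⟨C, -, hC⟩ := index_zmultiples_sup_range_le p U e (bc P₁) hx
  refine ⟨C, fun k hk ↦ ?_⟩
  haveI : NeZero (p ^ k) := ⟨pow_ne_zero k hp.ne_zero⟩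
  have hprimePow : IsPrimePow (p ^ k) := hp.isPrimePow.pow (Nat.one_le_iff_ne_zero.mp hk)
  have hPT := poitouTate_sum_localTatePairing_eq_zero_holds K
  have hEP : localEulerPoincareCharacteristic (v.adicCompletion K) :=
    LocalEPC.localEulerPoincareCharacteristic_holds _
  have hn0 : (((p ^ k : ℕ) : ℤ)) ≠ 0 := by exact_mod_cast pow_ne_zero k hp.ne_zero
  have hdiv : ∀ P : geomPoints W, ∃ Q : geomPoints W, (((p ^ k : ℕ) : ℤ)) • Q = P :=
    fun P ↦ W.zsmul_geomPoints_surjective_holds hn0 P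
  have hξ := kummerMapTorsion_mem_kummerOutside W (p ^ k) hdiv {Sum.inr v} P₁
  have hξP₀ : galoisCohomology.localization (W.torsionGaloisModule (((p ^ k : ℕ) : ℤ))) (Sum.inr v) 1
      (kummerMapTorsion W (((p ^ k : ℕ) : ℤ)) hdiv P₁) =
      W.localKummerMap (v.adicCompletion K) (Int.natCast_ne_zero.mpr (NeZero.ne (p ^ k))) (bc P₁) :=
    Summit.BirchSwinnertonDyer.Rank1Residual.X11b.KummerIndex.res_kummerMapTorsion_eq_localKummerMap W
      (v.adicCompletion K) _ hdiv P₁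
  have h := Summit.BirchSwinnertonDyer.Rank1Residual.X11b.Relaxation.relIndex_selmerGroup_kummerOutside_le_index_zmultiples_of_facts
    W (p ^ k) v hprimePow hPT hEP hξ (bc P₁) hξP₀
  refine h.trans ?_
  have h2 := hC k
  rwa [← Nat.cast_pow] at h2

end Relaxed

end Summit.BirchSwinnertonDyer.BirchSwinnertonDyer.Theorems.FlatBlindTwistSide

end
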